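import Literature.AnabelianGeometry.EtaleTheta.SettingModelMuTwo
import Literature.AnabelianGeometry.EtaleTheta.SettingModelKummerDataEmpty
import Literature.AnabelianGeometry.EtaleTheta.Discharge.Sec1Prop18
import HarnessLib

/-!
# [EtTh] Prop. 1.8 (`Ċ`-case) and Thm. 1.10 (i) as SCHEMATA: their universal closures at the root model
# (FROZEN FACT-LIST rows F-0511 `Prop18pm`, F-0512 `Thm110i`, F-0513 `Thm110iUnique`; proof-only)

S. Mochizuki, *The étale theta function and its Frobenioid-theoretic manifestations*, Publ. RIMS **45**
(2009), §1, Prop. 1.8 p. 28 (printed 254) and Thm. 1.10 (i) p. 29 (printed 255)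
[cite: MochizukiEtTh2009, Prop 1.8 p.28]. abc-iut cell, block F (fact-proving wave), seat abc-iut-f-113,
tranche 113 of `plan/F-TRANCHES.tsv`. PROOF-ONLY companion of abc-iut-L2-t1's
`ConstantMultipleRigidity.lean` (`Prop18pm`, `Thm110i`, `Thm110iUnique`) at abc-iut-L2-t1's ROOT MODEL
`MuTwoSetting.model p` (`SettingModelMuTwo.lean`: `Π^tp_C := (F₂ × G_{ℚ_p}) × ℤ/2`, discrete;
`Π^tp_Ẍ := Δ_Ẍ × G_{ℚ_p}` with `Δ_Ẍ` the words of even `a`- and `b`-exponent; `ε_μ := b`, `ε_± :=` the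
generator of `ℤ/2`; admissible `ε_Z := a`, `model_isAdmissibleEpsZ`). No definition of [EtTh] vocabulary,
no instance on an existing type, no named fact; nothing of [EtTh] is asserted.

All three rows are PARAMETRISED schemata (R5): predicates on an ABSTRACT `MuTwoSetting` (topological
groups `Π^tp_C ⊇ Π^tp_X ⊇ Π^tp_Ẍ`, free Kummer/evaluation data). This file records their kernel status
at the only model of the interface the tree holds:

* **F-0511 `Prop18pm` — universal closure REFUTED** (`exists_not_prop18pm_rootModel`,
  `not_forall_prop18pm`, via the general obstruction `MuTwoSetting.not_prop18pm_of_apply_not_mem`;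
  instance form at `γ = id` PROVED for every setting, `MuTwoSetting.prop18pm_refl`).
  The automorphism `Φ : (w, g, t) ↦ (w̄, g, t · (−1)^{|w|})` of the model's `Π^tp_C` (`w̄` = `w` with the
  two free generators swapped, `|w|` = total exponent sum) preserves `Π^tp_Ċ` (it swaps `ε_Z = a` and
  `ε_± ε_μ = (b, −1)`) and so restricts to an isomorphism of topological groups
  `γ : Π^tp_{Ċ} →̃ Π^tp_{Ċ}`; but no `Γ : Π^tp_C →̃ Π^tp_C` preserving the coverings restricts to `γ` up to an
  inner automorphism, since such a `Γ` would carry `ε_Z ∈ Π^tp_Ẋ` to a conjugate of `ε_± ε_μ ∉ Π^tp_X`. So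
  the typed `Prop18pm`, read as a closed fact `∀ (settings) (γ), …`, is FALSE: the conclusion of Prop. 1.8
  is anabelian input about THE tempered fundamental groups of the curves (print: [SemiAnbd] Thm. 6.8 (ii)
  and condition (II) "`C` is a `K`-core", which the interface does not carry), not a property of every
  abstract configuration of Def. 1.7 — consistent with abc-iut-L2-t1's `prop18pm_of_extension`
  (`Discharge/Sec1Prop18.lean`), which isolates exactly that input as hypotheses (a), (b), (d).
* **F-0512 `Thm110i`, F-0513 `Thm110iUnique` — hold at the root model, VACUOUSLY**
  (`thm110i_rootModel`, `thm110iUnique_rootModel`): both quantify over an étale theta datum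
  `E : EtaleThetaData`, and the root model carries none (abc-iut-w5-d171's
  `ThetaSetting.model_isEmpty_etaleThetaData`: `H¹` has no `2`-torsion there). So the root model can
  neither refute nor non-vacuously witness these two schemata; their genuine instance forms are the
  conditional theorems already in the tree (`thm110i_of_values_of_deltaCompat` and abc-iut-w5-d140's
  `thm110i_of_matching` over ANCHORED standard data; `thm110iUnique_of_signedFormula`,
  `thm110iUnique_of_translateValues`), whose binders are the value law of Prop. 1.4 (ii)(iii) at `τ^{±1}`
  and the matching of the 4-torsion decomposition groups — data the interface `StandardData` /
  `NonCuspidalPoint` leaves free (`evalAt`, `Dpt` are not tied to the coordinate; cf. `AnchoredPoint`). Also recorded: the trivial identity instance `thm110i_of_same_data` (one setting,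
  one standard datum, ANY `γ` and hypothesis structure: `Thm110i` is `P ↔ P`).

HONEST FRAMING: statements about OUR typed schemata at OUR degenerate consistency model; refuting the
universal closure of a typed schema is not a statement about [EtTh] Prop. 1.8, which concerns actual
curves; typed ≠ proved; no side is taken on [IUTchIII] Cor. 3.12 or on any author.
-/

noncomputable section

namespace Literature.AnabelianGeometry.EtaleTheta

namespace SettingModel

open Literature.AnabelianGeometry.SemiGraphs

variable (p : ℕ) [Fact p.Prime]

/-! ### A general obstruction: a compatible extension carries `Π^tp_Ẋ` to `Π^tp_Ẋ` -/

variable {p} in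
/-- **Obstruction to the conclusion of Prop. 1.8 (`Ċ`-case)**: if `γ : Π^tp_{Ċα} →̃ Π^tp_{Ċβ}` carries some
element of `Π^tp_{Ẋα}` OUTSIDE `Π^tp_{Ẋβ}`, then no isomorphism `Γ : Π^tp_{Cα} →̃ Π^tp_{Cβ}` preserving the
coverings restricts to `γ` up to an inner automorphism — for such a `Γ` one has
`c · γ(x) · c⁻¹ = Γ(x) ∈ Γ(Π^tp_{Ẋα}) = Π^tp_{Ẋβ}` and `Π^tp_{Ẋβ} ⊴ Π^tp_{Cβ}` ("induces an isomorphism between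
the commutative diagrams … `Π^tp_{Ẋ☐} → Π^tp_{X☐}` …", p. 28). [cite: MochizukiEtTh2009, Prop 1.8 p.28] -/
theorem _root_.Literature.AnabelianGeometry.EtaleTheta.MuTwoSetting.not_prop18pm_of_apply_not_mem
    {Mα Mβ : MuTwoSetting p} {εα : Mα.GtpC} {εβ : Mβ.GtpC} (hα : Mα.IsAdmissibleEpsZ εα)
    (hβ : Mβ.IsAdmissibleEpsZ εβ) (γ : Mα.dotC εα ≃ₜ* Mβ.dotC εβ) (x : Mα.dotC εα)
    (hx : (x : Mα.GtpC) ∈ Mα.dotX εα) (hγx : (γ.toMulEquiv x : Mβ.GtpC) ∉ Mβ.dotX εβ) :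
    ¬ Prop18pm hα hβ γ := by
  rintro ⟨Γ, hΓ, c, hc⟩
  apply hγx
  have h1 : Γ.toMulEquiv x.1 ∈ Mβ.dotX εβ := by
    rw [← hΓ.map_dotX]
    exact Subgroup.mem_map_of_mem Γ.toMulEquiv.toMonoidHom hx
  rw [hc x] at h1
  have h2 := (Mβ.dotX_normal εβ).conj_mem' _ h1 c
  have key : c⁻¹ * (c * (γ.toMulEquiv x).1 * c⁻¹) * c = (γ.toMulEquiv x).1 := by group
  rwa [key] at h2

/-! ### The root model: the generator swap and the exponent parity on `F₂` (private plumbing) -/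

/-- The generator swap of `F₂` is an involution. [folklore] -/
private theorem swap_swap (w : F₂) :
    FreeGroup.freeGroupCongr (Equiv.swap (0 : Fin 2) 1)
      (FreeGroup.freeGroupCongr (Equiv.swap (0 : Fin 2) 1) w) = w := by
  have h := (FreeGroup.freeGroupCongr (Equiv.swap (0 : Fin 2) 1)).apply_symm_apply w
  rwa [FreeGroup.freeGroupCongr_symm, Equiv.symm_swap] at h

/-- The swap exchanges the `a`-exponent sum and the `b`-exponent sum. [folklore] -/
private theorem heisHom_x_swap (w : F₂) :
    (heisHom (FreeGroup.freeGroupCongr (Equiv.swap (0 : Fin 2) 1) w)).x = (heisHom w).y := by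
  have h : (Heis.xHom.comp heisHom).comp
        (FreeGroup.freeGroupCongr (Equiv.swap (0 : Fin 2) 1)).toMonoidHom =
      Heis.yHom.comp heisHom := by
    refine FreeGroup.ext_hom _ _ fun i => ?_
    fin_cases i <;> simp [Heis.yHom]
  simpa [Heis.yHom] using DFunLike.congr_fun h w

/-- [folklore] -/
private theorem heisHom_y_swap (w : F₂) :
    (heisHom (FreeGroup.freeGroupCongr (Equiv.swap (0 : Fin 2) 1) w)).y = (heisHom w).x := by
  have h := heisHom_x_swap (FreeGroup.freeGroupCongr (Equiv.swap (0 : Fin 2) 1) w)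
  rw [swap_swap] at h
  exact h.symm

/-- The swap preserves `Δ_Ẍ` (even `a`- and `b`-exponents). [folklore] -/
private theorem swap_mem_deltaXdd {w : F₂} (hw : w ∈ deltaXdd) :
    FreeGroup.freeGroupCongr (Equiv.swap (0 : Fin 2) 1) w ∈ deltaXdd := by
  rw [deltaXdd, Subgroup.mem_comap, mem_heisMod_iff] at hw ⊢
  rw [heisHom_x_swap, heisHom_y_swap]
  exact ⟨hw.2, hw.1⟩

/-- The parity `(−1)^{x(w)+y(w)}` is multiplicative. [folklore] -/
private theorem parity_mul (v w : F₂) :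
    Multiplicative.ofAdd ((((heisHom (v * w)).x + (heisHom (v * w)).y : ℤ) : ZMod 2)) =
      Multiplicative.ofAdd ((((heisHom v).x + (heisHom v).y : ℤ) : ZMod 2)) *
        Multiplicative.ofAdd ((((heisHom w).x + (heisHom w).y : ℤ) : ZMod 2)) := by
  rw [← ofAdd_add, map_mul, Heis.mul_x, Heis.mul_y]
  push_cast
  congr 1
  ring

/-- … swap-invariant … [folklore] -/
private theorem parity_swap (w : F₂) :
    Multiplicative.ofAdd ((((heisHom (FreeGroup.freeGroupCongr (Equiv.swap (0 : Fin 2) 1) w)).x +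
        (heisHom (FreeGroup.freeGroupCongr (Equiv.swap (0 : Fin 2) 1) w)).y : ℤ) : ZMod 2)) =
      Multiplicative.ofAdd ((((heisHom w).x + (heisHom w).y : ℤ) : ZMod 2)) := by
  rw [heisHom_x_swap, heisHom_y_swap, add_comm]

/-- … trivial on `Δ_Ẍ` … [folklore] -/
private theorem parity_eq_one_of_mem_deltaXdd {w : F₂} (hw : w ∈ deltaXdd) :
    Multiplicative.ofAdd ((((heisHom w).x + (heisHom w).y : ℤ) : ZMod 2)) = 1 := by
  rw [deltaXdd, Subgroup.mem_comap, mem_heisMod_iff] at hw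
  obtain ⟨⟨m, hm⟩, ⟨n, hn⟩⟩ := hw
  rw [hm, hn]
  have h2 : (((((2 : ℕ) : ℤ) * m + ((2 : ℕ) : ℤ) * n : ℤ)) : ZMod 2) = 0 :=
    (ZMod.intCast_zmod_eq_zero_iff_dvd _ 2).mpr ⟨m + n, by push_cast; ring⟩
  rw [h2, ofAdd_zero]

/-- … and `−1` on the generator `a`. [folklore] -/
private theorem parity_of_zero :
    Multiplicative.ofAdd ((((heisHom (FreeGroup.of 0)).x + (heisHom (FreeGroup.of 0)).y : ℤ) : ZMod 2)) =
      Multiplicative.ofAdd 1 := by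
  simp

/-- Every element of `ℤ/2` (multiplicative) squares to `1`. [folklore] -/
private theorem mul_self_eq_one_zmod_two (t : Multiplicative (ZMod 2)) : t * t = 1 := by
  revert t; decide

/-- `A ↦ A × 1` under `Π^tp_X ↪ Π^tp_C = Π^tp_X × ℤ/2`. [folklore] -/
private theorem map_inclXM_eq_prod (A : Subgroup (PiTp p)) : A.map (inclXM p) = A.prod ⊥ := by
  ext x
  constructor
  · rintro ⟨y, hy, rfl⟩
    exact ⟨hy, (Subgroup.mem_bot).mpr rfl⟩
  · rintro ⟨hx1, hx2⟩
    exact ⟨x.1, hx1, Prod.ext rfl ((Subgroup.mem_bot.mp hx2).symm)⟩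

/-! ### F-0511: the universal closure of `Prop18pm` is refuted at the root model -/

/-- **F-0511, counter-instance: `Prop18pm` FAILS at the root model** for `α = β =` the model,
`ε_{Z,α} = ε_{Z,β} = a` and `γ := Φ|_{Π^tp_Ċ}`, where `Φ : ((w, g), t) ↦ ((w̄, g), t · (−1)^{|w|})` is the
automorphism of `Π^tp_C = (F₂ × G_{ℚ_p}) × ℤ/2` swapping the two free generators (`w̄`) and twisting the
`ℤ/2`-coordinate by the parity of the total exponent sum `|w|`: `Φ` fixes `Π^tp_Ẍ`, swaps `ε_Z = a` and
`ε_± ε_μ = (b, −1)`, hence preserves `Π^tp_Ċ = Π^tp_Ẍ · ⟨ε_Z⟩ · ⟨ε_± ε_μ⟩`; and `γ(ε_Z) = ε_± ε_μ ∉ Π^tp_X ⊇ Π^tp_Ẋ`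
while `ε_Z ∈ Π^tp_Ẋ`, so `MuTwoSetting.not_prop18pm_of_apply_not_mem` applies.
[cite: MochizukiEtTh2009, Prop 1.8 p.28] -/
theorem exists_not_prop18pm_rootModel :
    ∃ γ : (MuTwoSetting.model p).dotC (inclXM p (Del.ofF₂ (FreeGroup.of 0), 1)) ≃ₜ*
        (MuTwoSetting.model p).dotC (inclXM p (Del.ofF₂ (FreeGroup.of 0), 1)),
      ¬ Prop18pm (MuTwoSetting.model_isAdmissibleEpsZ p) (MuTwoSetting.model_isAdmissibleEpsZ p) γ := by
  -- `Φ` as an endomorphism of `Π^tp_C`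
  let φ : PiC p →* PiC p :=
    { toFun := fun g =>
        ((Del.ofF₂ (FreeGroup.freeGroupCongr (Equiv.swap (0 : Fin 2) 1) (Del.val g.1.1)), g.1.2),
          g.2 * Multiplicative.ofAdd
            ((((heisHom (Del.val g.1.1)).x + (heisHom (Del.val g.1.1)).y : ℤ) : ZMod 2)))
      map_one' := by simp
      map_mul' := fun g h => by
        refine Prod.ext (Prod.ext ?_ rfl) ?_
        · simp
        · simp only [Prod.fst_mul, Prod.snd_mul, map_mul (Del.val), parity_mul]
          exact mul_mul_mul_comm _ _ _ _ }
  have hφ : ∀ g : PiC p, φ g =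
      ((Del.ofF₂ (FreeGroup.freeGroupCongr (Equiv.swap (0 : Fin 2) 1) (Del.val g.1.1)), g.1.2),
        g.2 * Multiplicative.ofAdd
          ((((heisHom (Del.val g.1.1)).x + (heisHom (Del.val g.1.1)).y : ℤ) : ZMod 2))) :=
    fun _ => rfl
  -- `Φ` is an involution, hence an automorphism
  have hφφ : ∀ g : PiC p, φ (φ g) = g := by
    rintro ⟨⟨d, σ⟩, t⟩
    rw [hφ, hφ]
    refine Prod.ext (Prod.ext ?_ rfl) ?_
    · show Del.ofF₂ (FreeGroup.freeGroupCongr (Equiv.swap (0 : Fin 2) 1) (Del.val (Del.ofF₂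
        (FreeGroup.freeGroupCongr (Equiv.swap (0 : Fin 2) 1) (Del.val d))))) = d
      rw [Del.val_ofF₂, swap_swap]
      rfl
    · show t * Multiplicative.ofAdd ((((heisHom (Del.val d)).x + (heisHom (Del.val d)).y : ℤ) : ZMod 2)) *
          Multiplicative.ofAdd ((((heisHom (Del.val (Del.ofF₂ (FreeGroup.freeGroupCongr
            (Equiv.swap (0 : Fin 2) 1) (Del.val d))))).x + (heisHom (Del.val (Del.ofF₂
            (FreeGroup.freeGroupCongr (Equiv.swap (0 : Fin 2) 1) (Del.val d))))).y : ℤ) : ZMod 2)) = t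
      rw [Del.val_ofF₂, parity_swap, mul_assoc, mul_self_eq_one_zmod_two, mul_one]
  let Φ : PiC p ≃* PiC p :=
    MonoidHom.toMulEquiv φ φ (MonoidHom.ext hφφ) (MonoidHom.ext hφφ)
  have hΦ : ∀ g : PiC p, Φ g = φ g := fun _ => rfl
  -- `Φ(ε_Z) = ε_± ε_μ` and `Φ(ε_± ε_μ) = ε_Z`
  have hΦε : Φ (inclXM p (Del.ofF₂ (FreeGroup.of 0), 1)) =
      (MuTwoSetting.model p).epsPM * (MuTwoSetting.model p).epsMu := by
    rw [hΦ, hφ]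
    refine Prod.ext (Prod.ext ?_ rfl) ?_
    · show Del.ofF₂ (FreeGroup.freeGroupCongr (Equiv.swap (0 : Fin 2) 1)
          (Del.val (Del.ofF₂ (FreeGroup.of 0)))) = 1 * Del.ofF₂ (FreeGroup.of 1)
      rw [Del.val_ofF₂, one_mul]
      simp
    · show (1 : Multiplicative (ZMod 2)) * Multiplicative.ofAdd ((((heisHom (Del.val (Del.ofF₂
          (FreeGroup.of 0)))).x + (heisHom (Del.val (Del.ofF₂ (FreeGroup.of 0)))).y : ℤ) : ZMod 2)) =
        Multiplicative.ofAdd 1 * 1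
      rw [Del.val_ofF₂, parity_of_zero, one_mul, mul_one]
  have hΦε' : Φ ((MuTwoSetting.model p).epsPM * (MuTwoSetting.model p).epsMu) =
      inclXM p (Del.ofF₂ (FreeGroup.of 0), 1) := by
    have h := congrArg φ hΦε
    rw [hΦ, hφφ] at h
    rw [hΦ]
    exact h.symm
  -- `Φ(Π^tp_Ẍ) = Π^tp_Ẍ`
  have hΦXdd_le : (((Xdd p).map (inclXM p)).map Φ.toMonoidHom) ≤ (Xdd p).map (inclXM p) := by
    rw [map_inclXM_eq_prod]
    rintro _ ⟨g, ⟨⟨hg1, -⟩, hg2⟩, rfl⟩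
    have hg1' : Del.val g.1.1 ∈ deltaXdd := hg1
    have hg2' : g.2 = 1 := Subgroup.mem_bot.mp hg2
    show Φ g ∈ _
    rw [hΦ, hφ]
    refine ⟨⟨?_, trivial⟩, ?_⟩
    · show Del.val (Del.ofF₂ (FreeGroup.freeGroupCongr (Equiv.swap (0 : Fin 2) 1) (Del.val g.1.1))) ∈
        deltaXdd
      rw [Del.val_ofF₂]
      exact swap_mem_deltaXdd hg1'
    · show g.2 * Multiplicative.ofAdd ((((heisHom (Del.val g.1.1)).x +
          (heisHom (Del.val g.1.1)).y : ℤ) : ZMod 2)) ∈ (⊥ : Subgroup (Multiplicative (ZMod 2)))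
      rw [hg2', parity_eq_one_of_mem_deltaXdd hg1', one_mul]
      exact Subgroup.one_mem _
  have hΦXdd : ((Xdd p).map (inclXM p)).map Φ.toMonoidHom = (Xdd p).map (inclXM p) := by
    refine le_antisymm hΦXdd_le fun g hg => ⟨Φ g, hΦXdd_le ⟨g, hg, rfl⟩, ?_⟩
    show Φ (Φ g) = g
    rw [hΦ, hΦ]
    exact hφφ g
  -- `Φ(Π^tp_Ċ) = Π^tp_Ċ`
  have hΦC : ((MuTwoSetting.model p).dotC (inclXM p (Del.ofF₂ (FreeGroup.of 0), 1))).map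
      Φ.toMonoidHom = (MuTwoSetting.model p).dotC (inclXM p (Del.ofF₂ (FreeGroup.of 0), 1)) := by
    show ((Xdd p).map (inclXM p) ⊔ Subgroup.zpowers (inclXM p (Del.ofF₂ (FreeGroup.of 0), 1)) ⊔
        Subgroup.zpowers ((MuTwoSetting.model p).epsPM * (MuTwoSetting.model p).epsMu)).map
          Φ.toMonoidHom =
      (Xdd p).map (inclXM p) ⊔ Subgroup.zpowers (inclXM p (Del.ofF₂ (FreeGroup.of 0), 1)) ⊔
        Subgroup.zpowers ((MuTwoSetting.model p).epsPM * (MuTwoSetting.model p).epsMu)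
    rw [Subgroup.map_sup, Subgroup.map_sup, MonoidHom.map_zpowers, MonoidHom.map_zpowers, hΦXdd]
    change (Xdd p).map (inclXM p) ⊔ Subgroup.zpowers (Φ (inclXM p (Del.ofF₂ (FreeGroup.of 0), 1))) ⊔
        Subgroup.zpowers (Φ ((MuTwoSetting.model p).epsPM * (MuTwoSetting.model p).epsMu)) = _
    rw [hΦε, hΦε', sup_assoc, sup_assoc,
      sup_comm (Subgroup.zpowers (inclXM p (Del.ofF₂ (FreeGroup.of 0), 1)))]
  -- the witness `γ := Φ|_{Π^tp_Ċ}`, an isomorphism of (discrete) topological groups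
  haveI : DiscreteTopology (MuTwoSetting.model p).GtpC := inferInstanceAs (DiscreteTopology (PiC p))
  let γ : (MuTwoSetting.model p).dotC (inclXM p (Del.ofF₂ (FreeGroup.of 0), 1)) ≃ₜ*
      (MuTwoSetting.model p).dotC (inclXM p (Del.ofF₂ (FreeGroup.of 0), 1)) :=
    { (Φ.subgroupMap ((MuTwoSetting.model p).dotC (inclXM p (Del.ofF₂ (FreeGroup.of 0), 1)))).trans
        (MulEquiv.subgroupCongr hΦC) with
      continuous_toFun := continuous_of_discreteTopology
      continuous_invFun := continuous_of_discreteTopology }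
  -- `ε_Z ∈ Π^tp_Ẋ ⊆ Π^tp_Ċ`, and `γ(ε_Z) = ε_± ε_μ ∉ Π^tp_X ⊇ Π^tp_Ẋ`
  have hZX : inclXM p (Del.ofF₂ (FreeGroup.of 0), 1) ∈
      (MuTwoSetting.model p).dotX (inclXM p (Del.ofF₂ (FreeGroup.of 0), 1)) :=
    Subgroup.mem_sup_right (Subgroup.mem_zpowers _)
  have hZC : inclXM p (Del.ofF₂ (FreeGroup.of 0), 1) ∈
      (MuTwoSetting.model p).dotC (inclXM p (Del.ofF₂ (FreeGroup.of 0), 1)) :=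
    (MuTwoSetting.model p).dotX_le_dotC _ hZX
  refine ⟨γ, MuTwoSetting.not_prop18pm_of_apply_not_mem _ _ γ ⟨_, hZC⟩ hZX ?_⟩
  show Φ (inclXM p (Del.ofF₂ (FreeGroup.of 0), 1)) ∉
    (MuTwoSetting.model p).dotX (inclXM p (Del.ofF₂ (FreeGroup.of 0), 1))
  rw [hΦε]
  exact fun h => (MuTwoSetting.model p).epsPM_mul_epsMu_not_mem_range
    ((MuTwoSetting.model p).dotX_le_range (MuTwoSetting.model_isAdmissibleEpsZ p) h)

/-- **F-0511 `Prop18pm`: the UNIVERSAL CLOSURE of the schema is false** (SCHEMA-REFUTED; counter-instance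
`exists_not_prop18pm_rootModel`). What this does and does not say: the typed conclusion of Prop. 1.8
(`Ċ`-case) is not a property of every abstract configuration of Def. 1.7 — it is anabelian input about the
actual tempered fundamental groups ([SemiAnbd] Thm. 6.8 (ii) + condition (II); hypotheses (a), (b), (d) of
abc-iut-L2-t1's `prop18pm_of_extension`); nothing is claimed about [EtTh] Prop. 1.8 itself.
[cite: MochizukiEtTh2009, Prop 1.8 p.28] -/
theorem not_forall_prop18pm :
    ¬ ∀ (p : ℕ) [Fact p.Prime] (Mα Mβ : MuTwoSetting p) (εα : Mα.GtpC) (εβ : Mβ.GtpC)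
        (hα : Mα.IsAdmissibleEpsZ εα) (hβ : Mβ.IsAdmissibleEpsZ εβ) (γ : Mα.dotC εα ≃ₜ* Mβ.dotC εβ),
        Prop18pm hα hβ γ := by
  intro h
  obtain ⟨γ, hγ⟩ := exists_not_prop18pm_rootModel 2
  exact hγ (h 2 _ _ _ _ _ _ γ)

/-! ### F-0512, F-0513: `Thm110i`, `Thm110iUnique` at the root model (vacuous) and the identity instance -/

/-- **F-0512 `Thm110i` HOLDS at the root model — vacuously**: it quantifies over étale theta data
`Eα`, and `ThetaSetting.model p` carries no `EtaleThetaData` (abc-iut-w5-d171,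
`ThetaSetting.model_isEmpty_etaleThetaData`). The root model therefore cannot refute the schema; a
non-vacuous instance needs a model with genuine Kummer theory (none in the tree).
[cite: MochizukiEtTh2009, Thm 1.10 (i) p.29] -/
theorem thm110i_rootModel {Mβ : MuTwoSetting p} {εα : (MuTwoSetting.model p).GtpC} {εβ : Mβ.GtpC}
    {hCα : (MuTwoSetting.model p).toThetaSetting.Compat} {hCβ : Mβ.toThetaSetting.Compat}
    {Eα : (MuTwoSetting.model p).toThetaSetting.EtaleThetaData} {Eβ : Mβ.toThetaSetting.EtaleThetaData}
    {γ : (MuTwoSetting.model p).dotC εα ≃ₜ* Mβ.dotC εβ} (H : Thm110Hypothesis εα εβ hCα hCβ Eα Eβ γ)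
    (Sα : (MuTwoSetting.model p).StandardData Eα.toKummerData) (Sβ : Mβ.StandardData Eβ.toKummerData) :
    Thm110i H Sα Sβ :=
  ((ThetaSetting.model_isEmpty_etaleThetaData p).false Eα).elim

/-- **F-0513 `Thm110iUnique` HOLDS at the root model — vacuously** (no `EtaleThetaData` over
`ThetaSetting.model p`; same reading as `thm110i_rootModel`). [cite: MochizukiEtTh2009, Thm 1.10 (i) p.29] -/
theorem thm110iUnique_rootModel (hC : (MuTwoSetting.model p).toThetaSetting.Compat)
    {εZ : (MuTwoSetting.model p).GtpC} (hZ : (MuTwoSetting.model p).IsAdmissibleEpsZ εZ)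
    (E : (MuTwoSetting.model p).toThetaSetting.EtaleThetaData)
    (S : (MuTwoSetting.model p).StandardData E.toKummerData) : Thm110iUnique hC hZ E S :=
  ((ThetaSetting.model_isEmpty_etaleThetaData p).false E).elim

end SettingModel

/-- **F-0511, instance form PROVED (the identity)**: for every `MuTwoSetting` and every admissible `ε_Z`,
`Prop18pm` HOLDS for `γ = id : Π^tp_Ċ →̃ Π^tp_Ċ` (`Γ = id`, `γ_X = id`, Thm. 1.6 (i) for the identity) — by
abc-iut-L2-t1's `prop18pm_of_extension`. So the schema is refuted as a closed fact
(`SettingModel.not_forall_prop18pm`) but inhabited; its content is which NON-identity `γ` admit the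
anabelian inputs (a), (b), (d). [cite: MochizukiEtTh2009, Prop 1.8 p.28] -/
theorem MuTwoSetting.prop18pm_refl {p : ℕ} [Fact p.Prime] (M : MuTwoSetting p) {εZ : M.GtpC}
    (hZ : M.IsAdmissibleEpsZ εZ) : Prop18pm hZ hZ (ContinuousMulEquiv.refl (M.dotC εZ)) :=
  prop18pm_of_extension hZ hZ _ (ContinuousMulEquiv.refl M.GtpC)
    ⟨1, fun x => by rw [inv_one, mul_one, one_mul]; rfl⟩ (ContinuousMulEquiv.refl M.PiTemp)
    (fun _ => rfl) (Subgroup.map_id _)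

/-- **F-0512, the identity instance (trivial, recorded for the census)**: for ONE setting, ONE étale
theta datum and ONE standard datum on both sides — the shape of the only inhabited family of
`Thm110Hypothesis` in the tree, the identity witnesses of `Thm110HypothesisRefl.lean` — `Thm110i` reads
`P ↔ P`, whatever `γ` and the hypothesis structure are. The content of Thm. 1.10 (i) lies in `α ≠ β`
(resp. `Sα ≠ Sβ`), where the interface's free evaluation data enter (`ConstantMultipleRigiditySub.lean`,
rows r6/r7). [cite: MochizukiEtTh2009, Thm 1.10 (i) p.29] -/
theorem thm110i_of_same_data {p : ℕ} [Fact p.Prime] {M : MuTwoSetting p} {εZ : M.GtpC}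
    {hC : M.toThetaSetting.Compat} {E : M.toThetaSetting.EtaleThetaData}
    {γ : M.dotC εZ ≃ₜ* M.dotC εZ} (H : Thm110Hypothesis εZ εZ hC hC E E γ)
    (S : M.StandardData E.toKummerData) : Thm110i H S S :=
  Iff.rfl

end Literature.AnabelianGeometry.EtaleTheta

end
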